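import Summits.Parity.GeneralizedHardyLittlewood.Theorems.BeyondDiagonalBeatsQuarter.OffDiagPrincipalCoprime
import Summits.Parity.GeneralizedHardyLittlewood.Theorems.BeyondDiagonalBeatsQuarter.OffDiagBlockStrata
import HarnessLib

/-!
# Route `PrimeLevelFamEdge`, crux K_B (stmt-Parity-20343), line `diagonal_kernel_split` rev 4, plan Ω,
# a8P bridge (OMEGA-BLUEPRINT L6′) — **from the strata bookkeeping of `OffDiagCoreSplit` (`g = gcd(cs,h₁)`, modulus
# `|h₁|/g`, class `−(A/g)((cs)/g)⁻¹`, indicator `𝟙[g ∣ A ∧ class is a unit]`) to the single stratum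
# `gcd(s,h₁) = gcd(A,h₁) = g₀` and the coprime-restricted evaluation of `OffDiagPrincipalCoprime`**

`OffDiagPrincipalCoprime.intGcd_eq_intGcd_of_dvd_switch` says the switched variable `s` of a non-empty level class has
`gcd(s,h₁) = g₀ := gcd(A,h₁)` (`A = ab`). The core split books each `s` with `g := gcd(cs,h₁)`, modulus `|h₁|/g` and the
reduced class, and keeps the term iff `g ∣ A` and the class is a unit. This file identifies that indicator with
`gcd(s,h₁) = g₀` (for `(c,h₁) = 1`), re-indexes the surviving `s = g₀·s′` (`(s′, h₁/g₀) = 1`), and evaluates the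
principal `s`-series by `tsum_coprime_fourier2_intShift_eq` at the reduced signed modulus `h₁/g₀`:

* `intGcd_mul_left_eq_of_isCoprime` — `(c,h₁) = 1 ⇒ gcd(cs,h₁) = gcd(s,h₁)`;
* `intGcd_eq_mul_intGcd_div` — `g ∣ A`, `g ∣ h` ⇒ `gcd(A,h) = g·gcd(A/g, h/g)`;
* **`dvd_and_isUnit_class_iff_gcd_eq`** — for `h₁ ≠ 0`, `(c,h₁) = 1`, `g = gcd(cs,h₁)`:
  `(g ∣ A ∧ IsUnit(−(A/g)·((cs)/g)⁻¹ mod |h₁|/g)) ⟺ gcd(s,h₁) = gcd(A,h₁)`;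
* **`tsum_gcd_stratum_reindex`** — `Σ'_{s} 𝟙[gcd(s,h₁) = g₀]·F s = Σ'_{s′} 𝟙[(s′, h₁/g₀) = 1]·F(g₀s′)` (`g₀ ∣ h₁`);
* **`tsum_stratum_fourier2_intShift_eq`** — `Σ'_{s} 𝟙[gcd(s,h₁) = g₀]·Φ̂(ξ₁, s/h₁ + τ)
  = Σ_{e ∣ n₀} μ(e)·(n₀/e)·Σ'_{k} e(−τ(n₀/e)k)·𝓕(t₁ ↦ Φ(t₁,(n₀/e)k))(ξ₁)`, `n₀ = |h₁|/g₀` — the inner `s`-series of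
  `coreP` at a dual modulus `h₁`, up to the constant density `φ(n₀)⁻¹`.

Pure `ℤ`/`ZMod` algebra plus one re-indexing; theorems only; standard axioms. Helper toward
`stub_offDiagBelowSlack_io`; closes nothing.
«The programme SEARCHES and TYPES; no claim about Landau–Siegel zeros, Theorems 1–2 of arXiv:2211.02515 or
a repaired Margin232 until a kernel theorem says so.»
-/

noncomputable section

open Real MeasureTheory Filter Complex Finset
open scoped FourierTransform Topology ContDiff ArithmeticFunction.Moebius

namespace Summit.Parity.GeneralizedHardyLittlewood.Theorems.BeyondDiagonalBeatsQuarter.OffDiag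

open Literature.NumberTheory.Sieve.FriedlanderIwaniecPrimes

/-! ### §1. The strata indicator is `gcd(s, h₁) = gcd(A, h₁)` -/

/-- `(c, h) = 1 ⇒ gcd(c·s, h) = gcd(s, h)`. [folklore] -/
theorem intGcd_mul_left_eq_of_isCoprime {c h : ℤ} (hc : IsCoprime c h) (s : ℤ) :
    Int.gcd (c * s) h = Int.gcd s h := by
  apply Nat.dvd_antisymm
  · -- `gcd(cs,h)` is coprime to `c`, divides `cs`, hence divides `s`
    have hcop : IsCoprime ((Int.gcd (c * s) h : ℕ) : ℤ) c :=
      (hc.symm.of_isCoprime_of_dvd_left (Int.gcd_dvd_right (c * s) h))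
    have h1 : ((Int.gcd (c * s) h : ℕ) : ℤ) ∣ s :=
      hcop.dvd_of_dvd_mul_left (Int.gcd_dvd_left (c * s) h)
    exact Int.dvd_gcd h1 (Int.gcd_dvd_right (c * s) h)
  · exact Int.dvd_gcd (dvd_mul_of_dvd_right (Int.gcd_dvd_left s h) c) (Int.gcd_dvd_right s h)

/-- `g ∣ A`, `g ∣ h` (`g : ℕ`) ⇒ `gcd(A, h) = g·gcd(A/g, h/g)`. [folklore] -/
theorem intGcd_eq_mul_intGcd_div {A h : ℤ} {g : ℕ} (hgA : (g : ℤ) ∣ A) (hgh : (g : ℤ) ∣ h) :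
    Int.gcd A h = g * Int.gcd (A / g) (h / g) := by
  rcases Nat.eq_zero_or_pos g with rfl | hg
  · simp only [Nat.cast_zero, zero_dvd_iff] at hgA hgh
    subst hgA; subst hgh; simp
  · obtain ⟨A', rfl⟩ := hgA
    obtain ⟨h', rfl⟩ := hgh
    have hg0 : (g : ℤ) ≠ 0 := by exact_mod_cast hg.ne'
    rw [Int.mul_ediv_cancel_left _ hg0, Int.mul_ediv_cancel_left _ hg0, Int.gcd_mul_left, Int.natAbs_natCast]

/-- In `ZMod m`: `−x·u⁻¹` is a unit iff `x` is, when `u` is a unit. [folklore] -/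
theorem isUnit_neg_mul_inv_iff {m : ℕ} {x u : ZMod m} (hu : IsUnit u) : IsUnit (-x * u⁻¹) ↔ IsUnit x := by
  have hui : IsUnit u⁻¹ := isUnit_iff_exists_inv'.mpr ⟨u, ZMod.mul_inv_of_unit u hu⟩
  rw [neg_mul, IsUnit.neg_iff]
  exact ⟨isUnit_of_mul_isUnit_left, fun hx ↦ hx.mul hui⟩

/-- **The strata indicator of the core split is `gcd(s,h₁) = gcd(A,h₁)`.** For `h₁ ≠ 0`, `(c, h₁) = 1` and
`g = gcd(cs, h₁)`: `g ∣ A ∧ IsUnit(−(A/g)·((cs)/g)⁻¹ : ZMod (|h₁|/g))` iff `gcd(s, h₁) = gcd(A, h₁)`. [folklore] -/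
theorem dvd_and_isUnit_class_iff_gcd_eq {c h₁ : ℤ} (hh₁ : h₁ ≠ 0) (hc : IsCoprime c h₁) (A s : ℤ) {g : ℕ}
    (hg : Int.gcd (c * s) h₁ = g) :
    ((g : ℤ) ∣ A ∧ IsUnit (-((A / g : ℤ) : ZMod (h₁ / g).natAbs) * (((c * s / g : ℤ) : ZMod (h₁ / g).natAbs))⁻¹))
      ↔ Int.gcd s h₁ = Int.gcd A h₁ := by
  have hgs : Int.gcd s h₁ = g := by rw [← hg, intGcd_mul_left_eq_of_isCoprime hc]
  have hgh : (g : ℤ) ∣ h₁ := hg ▸ Int.gcd_dvd_right (c * s) h₁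
  have hgpos : 0 < g := by rw [← hgs]; exact Int.gcd_pos_of_ne_zero_right s hh₁
  -- `(cs)/g` is a unit modulo `|h₁|/g`
  have hcopd : IsCoprime (c * s / g) (h₁ / g) := isCoprime_div_gcd hh₁ hg
  have hu : IsUnit (((c * s / g : ℤ) : ZMod (h₁ / g).natAbs)) := by
    rw [ZMod.coe_int_isUnit_iff_isCoprime]
    exact ((isCoprime_natAbs_iff _ _).mpr hcopd).symm
  rw [isUnit_neg_mul_inv_iff hu, ZMod.coe_int_isUnit_iff_isCoprime, hgs]
  constructor
  · rintro ⟨hgA, hunit⟩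
    have hcop : IsCoprime (A / g) (h₁ / g) := ((isCoprime_natAbs_iff _ _).mp hunit.symm)
    rw [intGcd_eq_mul_intGcd_div hgA hgh, Int.isCoprime_iff_gcd_eq_one.mp hcop, mul_one]
  · intro hgA'
    have hgA : (g : ℤ) ∣ A := hgA' ▸ Int.gcd_dvd_left A h₁
    refine ⟨hgA, ?_⟩
    have h1 : g * Int.gcd (A / g) (h₁ / g) = g * 1 := by
      rw [mul_one, ← intGcd_eq_mul_intGcd_div hgA hgh, hgA']
    have h2 : Int.gcd (A / g) (h₁ / g) = 1 := Nat.eq_of_mul_eq_mul_left hgpos h1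
    exact ((isCoprime_natAbs_iff _ _).mpr (Int.isCoprime_iff_gcd_eq_one.mpr h2)).symm

/-! ### §2. Re-indexing the stratum and evaluating the principal `s`-series -/

/-- **Re-indexing the stratum `gcd(s,h₁) = g₀`.** For `g₀ ≥ 1` with `g₀ ∣ h₁` and any `F`:
`Σ'_{s} 𝟙[gcd(s,h₁) = g₀]·F s = Σ'_{s′} 𝟙[(s′, h₁/g₀) = 1]·F(g₀·s′)`. [folklore] -/
theorem tsum_gcd_stratum_reindex {h₁ : ℤ} {g₀ : ℕ} (hg₀ : 0 < g₀) (hdvd : (g₀ : ℤ) ∣ h₁) (F : ℤ → ℂ) :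
    ∑' s : ℤ, (if Int.gcd s h₁ = g₀ then F s else 0) =
      ∑' s' : ℤ, (if IsCoprime s' (h₁ / g₀) then F (g₀ * s') else 0) := by
  have hg0 : (g₀ : ℤ) ≠ 0 := by exact_mod_cast hg₀.ne'
  obtain ⟨h', hh'⟩ := hdvd
  have hdiv : h₁ / g₀ = h' := by rw [hh', Int.mul_ediv_cancel_left _ hg0]
  -- the stratum lies in the sublattice `g₀ℤ`
  have hsub : ∀ s : ℤ, (if Int.gcd s h₁ = g₀ then F s else 0) =
      (if (g₀ : ℤ) ∣ s then (if Int.gcd s h₁ = g₀ then F s else 0) else 0) := by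
    intro s
    by_cases hd : (g₀ : ℤ) ∣ s
    · rw [if_pos hd]
    · have hne : Int.gcd s h₁ ≠ g₀ := fun h ↦ hd (h ▸ Int.gcd_dvd_left s h₁)
      rw [if_neg hne, if_neg hd]
  rw [tsum_congr hsub, tsum_ite_dvd_eq_tsum_mul hg0]
  refine tsum_congr fun t ↦ ?_
  have hgcd : Int.gcd ((g₀ : ℤ) * t) h₁ = g₀ * Int.gcd t h' := by
    rw [hh', Int.gcd_mul_left, Int.natAbs_natCast]
  have hiff : Int.gcd ((g₀ : ℤ) * t) h₁ = g₀ ↔ IsCoprime t (h₁ / g₀) := by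
    rw [hgcd, hdiv, Int.isCoprime_iff_gcd_eq_one]
    constructor
    · intro h; exact Nat.eq_of_mul_eq_mul_left hg₀ (by rw [h, mul_one])
    · intro h; rw [h, mul_one]
  by_cases hc : IsCoprime t (h₁ / g₀)
  · rw [if_pos (hiff.mpr hc), if_pos hc]
  · rw [if_neg (fun h ↦ hc (hiff.mp h)), if_neg hc]

/-- **The principal `s`-series of one dual modulus, evaluated.** For `uncurry Φ` smooth of compact support,
`h₁ ≠ 0`, `g₀ ≥ 1` with `g₀ ∣ h₁`, `n₀ := |h₁/g₀|`:
`Σ'_{s} 𝟙[gcd(s,h₁) = g₀]·Φ̂(ξ₁, s/h₁ + τ) = Σ_{e ∣ n₀} μ(e)·(n₀/e)·Σ'_{k} e(−τ(n₀/e)k)·𝓕(t₁ ↦ Φ(t₁,(n₀/e)k))(ξ₁)`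
(`s = g₀s′`, `s/h₁ = s′/(h₁/g₀)`, then `tsum_coprime_fourier2_intShift_eq`). With `g₀ = gcd(ab,h₁)` this is the inner
`s`-series of `coreP` at `h₁`, up to the density `φ(n₀)⁻¹` (`dvd_and_isUnit_class_iff_gcd_eq`). [folklore] -/
theorem tsum_stratum_fourier2_intShift_eq {Φ : ℝ → ℝ → ℂ} (hΦ : ContDiff ℝ ∞ (Function.uncurry Φ))
    (hΦc : HasCompactSupport (Function.uncurry Φ)) {h₁ : ℤ} (hh₁ : h₁ ≠ 0) {g₀ : ℕ} (hg₀ : 0 < g₀)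
    (hdvd : (g₀ : ℤ) ∣ h₁) (τ ξ₁ : ℝ) :
    ∑' s : ℤ, (if Int.gcd s h₁ = g₀ then fourier2 Φ ξ₁ ((s : ℝ) / h₁ + τ) else 0) =
      ∑ e ∈ (h₁ / g₀).natAbs.divisors, (μ e : ℂ) * ((((h₁ / g₀).natAbs / e : ℕ) : ℂ) *
        ∑' k : ℤ, (𝐞 (-(τ * (((h₁ / g₀).natAbs / e : ℕ) * k))) : ℂ) *
          𝓕 (fun t₁ : ℝ ↦ Φ t₁ (((h₁ / g₀).natAbs / e : ℕ) * k)) ξ₁) := by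
  have hg0 : (g₀ : ℤ) ≠ 0 := by exact_mod_cast hg₀.ne'
  obtain ⟨h', hh'⟩ := hdvd
  have hdiv : h₁ / g₀ = h' := by rw [hh', Int.mul_ediv_cancel_left _ hg0]
  have hh'0 : h' ≠ 0 := by rintro rfl; exact hh₁ (by rw [hh', mul_zero])
  rw [tsum_gcd_stratum_reindex hg₀ ⟨h', hh'⟩]
  have hfreq : ∀ s' : ℤ, (((g₀ : ℤ) * s' : ℤ) : ℝ) / (h₁ : ℝ) = (s' : ℝ) / (h' : ℝ) := by
    intro s'
    rw [hh']
    push_cast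
    have hg0R : (g₀ : ℝ) ≠ 0 := by exact_mod_cast hg₀.ne'
    have hh'R : (h' : ℝ) ≠ 0 := by exact_mod_cast hh'0
    field_simp
  simp_rw [hfreq, hdiv]
  exact tsum_coprime_fourier2_intShift_eq hΦ hΦc hh'0 τ ξ₁

end Summit.Parity.GeneralizedHardyLittlewood.Theorems.BeyondDiagonalBeatsQuarter.OffDiag
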